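import Literature.Computability.Complexity.BrickAlgebra
import Literature.Computability.Complexity.BPPSubsetAlmostP
import Literature.Computability.Complexity.LengthCompare
import HarnessLib

/-!
# Crux `ArithStatLadder.IqThreeNotBPP` (stmt-QuantumAdvantage-14864)

Stub `stub_orVerdictP` of the line `Sketch`: the OR-verdict with length guard is in `P`.

The closure of `BPP` under one-sided randomized reductions runs an adaptive-query program whose
final verdict language receives `⟨⟨x, R⟩, acc⟩ = boolPair (boolPair x R) acc` (`acc` = the answer
bits) and accepts iff `n₀ ≤ |x|` and some answer bit is `1` (`true ∈ acc`). This language is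
`((fstF ∘ fstF) ⁻¹' {x | n₀ ≤ |x|}) ∩ (sndF ⁻¹' {acc | true ∈ acc})`; the first factor is in `P` by
`setOf_le_length_mem_P` and `preimage_mem_P`, the second has the one-bit `FP` decider
`notFn (isNilFn ∘ norm)` (`true ∈ acc ↔ ⟦acc⟧ ≠ 0 ↔ norm acc ≠ ε`), and `P` is closed under `∩`
(`inter_mem_P`).
-/

set_option linter.dupNamespace false -- D-0017: single-problem summit ⇒ QuantumAdvantage.QuantumAdvantage by design

namespace Summit.QuantumAdvantage.QuantumAdvantage.Theorems.IqThreeNotBPP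

open _root_.Computability Literature.Computability.Complexity Literature.Computability.Complexity.Brick

/-- A bit string contains a `1` iff its little-endian value is nonzero. [folklore] -/
theorem true_mem_iff_bitsToNat_ne_zero : ∀ l : List Bool, true ∈ l ↔ bitsToNat l ≠ 0
  | [] => by simp
  | b :: l => by
    rw [List.mem_cons, bitsToNat_cons, true_mem_iff_bitsToNat_ne_zero l]
    cases b <;> simp

/-- The one-bit `FP` test "some bit is `1`": `notFn (isNilFn ∘ norm) acc = [decide (true ∈ acc)]`.
[folklore] -/
theorem notFn_isNilFn_norm_apply (acc : List Bool) :
    notFn (isNilFn ∘ Literature.Computability.Complexity.norm) acc = [decide (true ∈ acc)] := by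
  have happ : notFn (isNilFn ∘ Literature.Computability.Complexity.norm) acc =
      [!decide (Literature.Computability.Complexity.norm acc = [])] :=
    notFn_apply (b := decide (Literature.Computability.Complexity.norm acc = [])) rfl
  rw [happ]
  by_cases h : true ∈ acc
  · have h2 : Literature.Computability.Complexity.norm acc ≠ [] := fun h0 =>
      (true_mem_iff_bitsToNat_ne_zero acc).1 h ((norm_eq_nil_iff acc).1 h0)
    rw [decide_eq_false h2, decide_eq_true h]
    rfl
  · have h2 : Literature.Computability.Complexity.norm acc = [] :=
      (norm_eq_nil_iff acc).2 (by
        by_contra h0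
        exact h ((true_mem_iff_bitsToNat_ne_zero acc).2 h0))
    rw [decide_eq_true h2, decide_eq_false h]
    rfl

/-- **The OR language is in `P`**: `{acc | true ∈ acc} ∈ P` (decider `notFn (isNilFn ∘ norm)`).
[folklore] -/
theorem setOf_true_mem_mem_P : ({acc : List Bool | true ∈ acc} : Language Bool) ∈ Classes.P := by
  refine mem_P_of_mem_FP (notFn_mem_FP (comp_mem_FP isNilFn_mem_FP norm_mem_FP)) _ fun acc => ?_
  rw [notFn_isNilFn_norm_apply]
  constructor
  · intro h
    have h1 : true ∈ acc := h
    rw [decide_eq_true h1]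
  · intro h
    have h1 : ¬ true ∈ acc := h
    rw [decide_eq_false h1]

/-- **Stub `stub_orVerdictP`**: the OR-verdict with length guard,
`{⟨⟨x, R⟩, acc⟩ | n₀ ≤ |x| ∧ 1 ∈ acc}`, is in `P` — it is the intersection of the `FP`-preimages
`(fstF ∘ fstF) ⁻¹' {x | n₀ ≤ |x|}` and `sndF ⁻¹' {acc | true ∈ acc}` of two `P` languages. -/
theorem stub_orVerdictP :
    ∀ n₀ : ℕ, ({z : List Bool | n₀ ≤ (fstF (fstF z)).length ∧ true ∈ sndF z} : Language Bool) ∈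
      Classes.P := by
  intro n₀
  have h₁ : ((fstF ∘ fstF) ⁻¹' ({x : List Bool | n₀ ≤ x.length} : Language Bool) : Language Bool) ∈
      Classes.P :=
    preimage_mem_P (setOf_le_length_mem_P n₀) (comp_mem_FP fstF_mem_FP fstF_mem_FP)
  have h₂ : (sndF ⁻¹' ({acc : List Bool | true ∈ acc} : Language Bool) : Language Bool) ∈ Classes.P :=
    preimage_mem_P setOf_true_mem_mem_P sndF_mem_FP
  have hEq : ({z : List Bool | n₀ ≤ (fstF (fstF z)).length ∧ true ∈ sndF z} : Language Bool) =
      ((fstF ∘ fstF) ⁻¹' ({x : List Bool | n₀ ≤ x.length} : Language Bool) : Language Bool) ⊓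
        (sndF ⁻¹' ({acc : List Bool | true ∈ acc} : Language Bool) : Language Bool) :=
    Set.ext fun _ => Iff.rfl
  rw [hEq]
  exact inter_mem_P h₁ h₂

end Summit.QuantumAdvantage.QuantumAdvantage.Theorems.IqThreeNotBPP
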